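import Mathlib
import HarnessLib
import Literature.NumberTheory.Automorphic.GaloisActionPlaces
import Literature.NumberTheory.Automorphic.PairLFunctionBaseChange
import Literature.NumberTheory.Automorphic.TunnellOctahedralLocal
import Literature.NumberTheory.Automorphic.AsaiSign
import Literature.NumberTheory.GaloisRepresentations.FrobeniusPlaces
import Literature.NumberTheory.GaloisRepresentations.FrobeniusDensityTheorem

/-!
# Places of a quadratic extension and regrouping of Euler products along `w ↦ w ∩ 𝓞_K`
(helper file of the Klein-cube line for crux `InducedSquareAscent`, route `ExteriorSquareAscent`)

For a Galois quadratic extension `L/K` with non-trivial automorphism `τ`: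

* `fibre_of_inertiaDeg_eq_one`, `inertiaDeg_eq_one_of_exists`, `fibre_of_not_exists_inertiaDeg_eq_one`
  — above a place `v` of `K` unramified in `L`, either every place has residue degree `1`, the places
  over `v` are `w ≠ τ • w` and `q_w = q_v`, or there is a single place `w = τ • w` of degree `2`
  with `q_w = q_v²` (`g · f = 2`, Neukirch I (9.2); Cassels–Fröhlich VII Prop. 1.2 (ii));
* `eventually_ramificationIdxIn_eq_one`, `finite_setOf_under_mem` — finiteness bookkeeping;
* `regroup_tprod`, `regroup_tprod'` — **Arthur–Clozel, Ch. 3, Lemma 4.3 bookkeeping in degree 2**: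
  an unconditional product over the places `w` of `L` with `w ∩ 𝓞_K ∉ S` equals the product over
  `v ∉ S` of the fibre products `g w · g (τ • w)` (split `v`) / `g w` (inert `v`), for multipliable
  families (`Multipliable.tprod_sigma'` along `placesNotOverEquivSigma`).

Everything here is elementary and proved; no named fact is used.
-/

set_option linter.unusedVariables false
set_option linter.dupNamespace false

noncomputable section

namespace Summit.Langlands.Langlands.Theorems.InducedSquareAscentKleinCube

open scoped Classical NumberField Topology
open Filter IsDedekindDomain NumberField
open Literature.NumberTheory.Automorphic

variable {K L : Type} [Field K] [NumberField K] [Field L] [NumberField L] [Algebra K L]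

/-! ### Fibres of `w ↦ w ∩ 𝓞_K` in a quadratic Galois extension -/

/-- `Gal(L/K) = {1, τ}` acts transitively on the places over `v`: every place of `L` over the
same place of `K` as `w` is `w` or `τ • w`. [folklore] -/
theorem eq_or_eq_smul_of_under_eq [IsGalois K L] (hdeg : Module.finrank K L = 2)
    {τ : L ≃ₐ[K] L} (hτ : τ ≠ 1) {w w' : HeightOneSpectrum (𝓞 L)}
    (h : w'.under (𝓞 K) = w.under (𝓞 K)) : w' = w ∨ w' = τ • w := by
  obtain ⟨σ, hσ⟩ := HeightOneSpectrum.exists_algEquiv_smul_eq K h.symm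
  rcases AlgEquiv.eq_one_or_eq_of_finrank_eq_two hdeg hτ σ with rfl | rfl
  · left; simpa using hσ.symm
  · right; exact hσ.symm

/-- The residue degree is constant on the places over a given place (Galois extension).
[folklore] -/
theorem inertiaDeg_eq_of_under_eq [IsGalois K L] {w w' : HeightOneSpectrum (𝓞 L)}
    (h : w'.under (𝓞 K) = w.under (𝓞 K)) :
    w'.asIdeal.inertiaDeg (𝓞 K) = w.asIdeal.inertiaDeg (𝓞 K) := by
  rw [inertiaDeg_eq_inertiaDegIn_under (F := K) w', inertiaDeg_eq_inertiaDegIn_under (F := K) w, h]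

/-- If some place over `v` has residue degree `1`, all places over `v` have residue degree `1`.
[folklore] -/
theorem inertiaDeg_eq_one_of_exists [IsGalois K L] {v : HeightOneSpectrum (𝓞 K)}
    (hex : ∃ w : HeightOneSpectrum (𝓞 L), w.under (𝓞 K) = v ∧ w.asIdeal.inertiaDeg (𝓞 K) = 1)
    {w : HeightOneSpectrum (𝓞 L)} (hw : w.under (𝓞 K) = v) : w.asIdeal.inertiaDeg (𝓞 K) = 1 := by
  obtain ⟨w₀, hw₀, hf₀⟩ := hex
  rw [inertiaDeg_eq_of_under_eq (hw.trans hw₀.symm), hf₀]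

/-- **The split fibre.** Over a place `v` of `K` unramified in the quadratic Galois extension `L`,
a place `w` of residue degree `1` satisfies `τ • w ≠ w`, `q_w = q_v`, and the places over `v` are
exactly `w` and `τ • w` (`g f = 2`). [folklore] -/
theorem fibre_of_inertiaDeg_eq_one [IsGalois K L] (hdeg : Module.finrank K L = 2)
    {τ : L ≃ₐ[K] L} (hτ : τ ≠ 1) {v : HeightOneSpectrum (𝓞 K)}
    (hv : v.asIdeal.ramificationIdxIn (𝓞 L) = 1) {w : HeightOneSpectrum (𝓞 L)}
    (hw : w.under (𝓞 K) = v) (hf : w.asIdeal.inertiaDeg (𝓞 K) = 1) :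
    τ • w ≠ w ∧ w.residueCard = v.residueCard ∧
      ∀ w' : HeightOneSpectrum (𝓞 L), w'.under (𝓞 K) = v → w' = w ∨ w' = τ • w := by
  have hall : ∀ w' : HeightOneSpectrum (𝓞 L), w'.under (𝓞 K) = v → w' = w ∨ w' = τ • w :=
    fun w' hw' => eq_or_eq_smul_of_under_eq hdeg hτ (hw'.trans hw.symm)
  refine ⟨fun hfix => ?_, ?_, hall⟩
  · -- if `τ • w = w` the fibre is `{w}`, of cardinality `1`, but `g · f = 2` with `f = 1`
    have hcard := card_placesOver_mul_inertiaDegIn (F := K) (E := L) v hv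
    have hfin : (w.under (𝓞 K)).asIdeal.inertiaDegIn (𝓞 L) = 1 := by
      rw [← inertiaDeg_eq_inertiaDegIn_under (F := K) w, hf]
    rw [hw] at hfin
    rw [hfin, mul_one, hdeg] at hcard
    haveI := finite_placesOver (E := L) v
    have hsub : Subsingleton {w' : HeightOneSpectrum (𝓞 L) // w'.under (𝓞 K) = v} := by
      refine ⟨fun a b => Subtype.ext ?_⟩
      rcases hall a.1 a.2 with ha | ha <;> rcases hall b.1 b.2 with hb | hb <;>
        simp only [ha, hb, hfix]
    have : Nat.card {w' : HeightOneSpectrum (𝓞 L) // w'.under (𝓞 K) = v} ≤ 1 :=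
      Finite.card_le_one_iff_subsingleton.mpr hsub
    omega
  · have hq := residueCard_eq_pow_inertiaDeg (F := K) w
    rw [hf, pow_one, hw] at hq
    exact hq

/-- **The inert fibre.** Over a place `v` of `K` unramified in the quadratic Galois extension `L`
with no place of residue degree `1` above it, there is a single place `w`, of residue degree `2`,
fixed by `τ`, with `q_w = q_v²`. [folklore] -/
theorem fibre_of_not_exists_inertiaDeg_eq_one [IsGalois K L] (hdeg : Module.finrank K L = 2)
    {τ : L ≃ₐ[K] L} (hτ : τ ≠ 1) {v : HeightOneSpectrum (𝓞 K)}
    (hv : v.asIdeal.ramificationIdxIn (𝓞 L) = 1)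
    (hne : ¬ ∃ w : HeightOneSpectrum (𝓞 L), w.under (𝓞 K) = v ∧ w.asIdeal.inertiaDeg (𝓞 K) = 1) :
    ∃ w : HeightOneSpectrum (𝓞 L), w.under (𝓞 K) = v ∧ w.asIdeal.inertiaDeg (𝓞 K) = 2 ∧
      τ • w = w ∧ w.residueCard = v.residueCard ^ 2 ∧
      ∀ w' : HeightOneSpectrum (𝓞 L), w'.under (𝓞 K) = v → w' = w := by
  -- a place over `v` exists
  have hne0 : Nat.card {w : HeightOneSpectrum (𝓞 L) // w.under (𝓞 K) = v} ≠ 0 := by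
    rw [card_placesOver (E := L) v]
    exact IsDedekindDomain.primesOver_ncard_ne_zero v.asIdeal (𝓞 L)
  obtain ⟨⟨w, hw⟩⟩ := (Nat.card_ne_zero.mp hne0).1
  have hf2 : w.asIdeal.inertiaDeg (𝓞 K) = 2 := by
    rcases inertiaDeg_eq_one_or_two_of_finrank_eq_two hdeg v w
        (by rw [← hw]; rfl) with h1 | h2
    · exact absurd ⟨w, hw, h1⟩ hne
    · exact h2
  have hall : ∀ w' : HeightOneSpectrum (𝓞 L), w'.under (𝓞 K) = v → w' = w := by
    intro w' hw'
    have hcard := card_placesOver_mul_inertiaDegIn (F := K) (E := L) v hv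
    have hfin : (w.under (𝓞 K)).asIdeal.inertiaDegIn (𝓞 L) = 2 := by
      rw [← inertiaDeg_eq_inertiaDegIn_under (F := K) w, hf2]
    rw [hw] at hfin
    rw [hfin, hdeg] at hcard
    have h1 : Nat.card {w' : HeightOneSpectrum (𝓞 L) // w'.under (𝓞 K) = v} = 1 := by omega
    haveI := finite_placesOver (E := L) v
    have hsub := (Nat.card_eq_one_iff_unique.mp h1).1
    exact congrArg Subtype.val (hsub.elim ⟨w', hw'⟩ ⟨w, hw⟩)
  refine ⟨w, hw, hf2, hall _ ?_, ?_, hall⟩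
  · rw [HeightOneSpectrum.under_algEquiv_smul, hw]
  · have hq := residueCard_eq_pow_inertiaDeg (F := K) w
    rw [hf2, hw] at hq
    exact hq

omit [NumberField K] [NumberField L] in
/-- `τ² = 1` for the non-trivial automorphism of a quadratic extension, on places. [folklore] -/
theorem smul_smul_eq_self (hdeg : Module.finrank K L = 2) (τ : L ≃ₐ[K] L)
    (w : HeightOneSpectrum (𝓞 L)) : τ • τ • w = w := by
  rw [smul_smul, AlgEquiv.mul_self_eq_one_of_finrank_eq_two hdeg τ, one_smul]

/-! ### Finiteness -/

/-- Almost every place of `K` is unramified in `L` (`e = 1`). [folklore] -/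
theorem eventually_ramificationIdxIn_eq_one [IsGalois K L] :
    ∀ᶠ v : HeightOneSpectrum (𝓞 K) in cofinite, v.asIdeal.ramificationIdxIn (𝓞 L) = 1 :=
  (Filter.eventually_cofinite.2
    (Literature.NumberTheory.GaloisRepresentations.finite_setOf_not_isUnramifiedIn K L)).mono
    fun _ hv =>
      Literature.NumberTheory.GaloisRepresentations.ramificationIdxIn_eq_one_of_isUnramifiedIn hv

/-- Finitely many places of `L` lie over a finite set of places of `K`. [folklore] -/
theorem finite_setOf_under_mem {S : Set (HeightOneSpectrum (𝓞 K))} (hS : S.Finite) :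
    {w : HeightOneSpectrum (𝓞 L) | w.under (𝓞 K) ∈ S}.Finite := by
  have : {w : HeightOneSpectrum (𝓞 L) | w.under (𝓞 K) ∈ S} =
      ⋃ v ∈ S, {w : HeightOneSpectrum (𝓞 L) | w.under (𝓞 K) = v} := by
    ext w; simp
  rw [this]
  refine hS.biUnion fun v _ => ?_
  haveI := finite_placesOver (E := L) v
  have hr := Set.finite_range
    (Subtype.val : {w : HeightOneSpectrum (𝓞 L) // w.under (𝓞 K) = v} → HeightOneSpectrum (𝓞 L))
  rwa [Subtype.range_coe_subtype] at hr

/-- "Almost all `w`" from "almost all `v`": a cofinite condition on places of `K` pulls back to a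
cofinite condition on places of `L` along `w ↦ w ∩ 𝓞_K` (finite fibres). [folklore] -/
theorem tendsto_under_cofinite :
    Tendsto (fun w : HeightOneSpectrum (𝓞 L) => w.under (𝓞 K)) cofinite cofinite := by
  intro s hs
  rw [Filter.mem_cofinite] at hs
  rw [Filter.mem_map, Filter.mem_cofinite, ← Set.preimage_compl]
  exact finite_setOf_under_mem (K := K) (L := L) hs

/-! ### Regrouping of unconditional products -/

/-- **Fibre products.** Over `v ∉ S` (all unramified), the product of `g` over the places of `L`
above `v` is `g w · g (τ • w)` for any degree-one `w ∣ v`, and `g w` for a degree-two `w ∣ v`.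
[folklore] -/
theorem tprod_fibre_eq [IsGalois K L] (hdeg : Module.finrank K L = 2) {τ : L ≃ₐ[K] L} (hτ : τ ≠ 1)
    (g : HeightOneSpectrum (𝓞 L) → ℂ) {v : HeightOneSpectrum (𝓞 K)}
    (hv : v.asIdeal.ramificationIdxIn (𝓞 L) = 1) :
    (∀ w : HeightOneSpectrum (𝓞 L), w.under (𝓞 K) = v → w.asIdeal.inertiaDeg (𝓞 K) = 1 →
      ∏' c : {w : HeightOneSpectrum (𝓞 L) // w.under (𝓞 K) = v}, g c.1 = g w * g (τ • w)) ∧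
    (∀ w : HeightOneSpectrum (𝓞 L), w.under (𝓞 K) = v → w.asIdeal.inertiaDeg (𝓞 K) = 2 →
      ∏' c : {w : HeightOneSpectrum (𝓞 L) // w.under (𝓞 K) = v}, g c.1 = g w) := by
  haveI := finite_placesOver (E := L) v
  haveI : Fintype {w : HeightOneSpectrum (𝓞 L) // w.under (𝓞 K) = v} := Fintype.ofFinite _
  constructor
  · intro w hw hf
    obtain ⟨hne, -, hall⟩ := fibre_of_inertiaDeg_eq_one hdeg hτ hv hw hf
    have hτw : (τ • w).under (𝓞 K) = v := by rw [HeightOneSpectrum.under_algEquiv_smul, hw]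
    rw [tprod_fintype]
    have huniv : (Finset.univ : Finset {w : HeightOneSpectrum (𝓞 L) // w.under (𝓞 K) = v}) =
        {⟨w, hw⟩, ⟨τ • w, hτw⟩} := by
      ext c
      simp only [Finset.mem_univ, Finset.mem_insert, Finset.mem_singleton, true_iff]
      rcases hall c.1 c.2 with h | h
      · exact Or.inl (Subtype.ext h)
      · exact Or.inr (Subtype.ext h)
    rw [huniv, Finset.prod_pair]
    exact fun h => hne (congrArg Subtype.val h).symm
  · intro w hw hf
    have hne : ¬ ∃ w : HeightOneSpectrum (𝓞 L), w.under (𝓞 K) = v ∧ w.asIdeal.inertiaDeg (𝓞 K) = 1 := by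
      rintro ⟨w₀, hw₀, hf₀⟩
      have := inertiaDeg_eq_of_under_eq (K := K) (hw.trans hw₀.symm)
      omega
    obtain ⟨w₀, hw₀, -, -, -, hall⟩ := fibre_of_not_exists_inertiaDeg_eq_one hdeg hτ hv hne
    have hww : w = w₀ := hall w hw
    subst hww
    rw [tprod_fintype]
    have huniv : (Finset.univ : Finset {w' : HeightOneSpectrum (𝓞 L) // w'.under (𝓞 K) = v}) =
        {⟨w, hw⟩} := by
      ext c
      simp only [Finset.mem_univ, Finset.mem_singleton, true_iff]
      exact Subtype.ext (hall c.1 c.2)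
    rw [huniv, Finset.prod_singleton]

/-- **Regrouping along `w ↦ w ∩ 𝓞_K` (Arthur–Clozel, Ch. 3, Lemma 4.3, degree 2).** Let `S` contain
the places of `K` ramified in `L`, `g` a function on the places of `L` and `h` on the places of `K`
with `g w · g (τ • w) = h v` for degree-one `w ∣ v ∉ S` and `g w = h v` for degree-two `w ∣ v ∉ S`.
If `∏_{w ∩ 𝓞_K ∉ S} g w` is multipliable, then so is `∏_{v ∉ S} h v` and the two products agree.
[cite: ArthurClozelAMS120, Ch. 3, Lemma 4.3] -/
theorem regroup_tprod [IsGalois K L] (hdeg : Module.finrank K L = 2) {τ : L ≃ₐ[K] L} (hτ : τ ≠ 1)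
    (S : Set (HeightOneSpectrum (𝓞 K))) (g : HeightOneSpectrum (𝓞 L) → ℂ)
    (h : HeightOneSpectrum (𝓞 K) → ℂ)
    (hS : ∀ v ∉ S, v.asIdeal.ramificationIdxIn (𝓞 L) = 1)
    (hsplit : ∀ v ∉ S, ∀ w : HeightOneSpectrum (𝓞 L), w.under (𝓞 K) = v →
      w.asIdeal.inertiaDeg (𝓞 K) = 1 → g w * g (τ • w) = h v)
    (hinert : ∀ v ∉ S, ∀ w : HeightOneSpectrum (𝓞 L), w.under (𝓞 K) = v →
      w.asIdeal.inertiaDeg (𝓞 K) = 2 → g w = h v)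
    (hg : Multipliable (fun w : {w : HeightOneSpectrum (𝓞 L) // w.under (𝓞 K) ∉ S} => g w.1)) :
    Multipliable (fun v : {v : HeightOneSpectrum (𝓞 K) // v ∉ S} => h v.1) ∧
      ∏' w : {w : HeightOneSpectrum (𝓞 L) // w.under (𝓞 K) ∉ S}, g w.1 =
        ∏' v : {v : HeightOneSpectrum (𝓞 K) // v ∉ S}, h v.1 := by
  set e := placesNotOverEquivSigma (E := L) S with he
  set X : {w : HeightOneSpectrum (𝓞 L) // w.under (𝓞 K) ∉ S} → ℂ := fun w => g w.1 with hX
  have hmul : Multipliable (X ∘ e) := (Equiv.multipliable_iff e).mpr hg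
  have h₁ : ∀ v : {v : HeightOneSpectrum (𝓞 K) // v ∉ S},
      Multipliable fun c : {w : HeightOneSpectrum (𝓞 L) // w.under (𝓞 K) = v.1} =>
        (X ∘ e) ⟨v, c⟩ := fun v => by
    haveI := finite_placesOver (E := L) v.1
    exact Multipliable.of_finite
  -- the fibre products are the values of `h`
  have hinner : ∀ v : {v : HeightOneSpectrum (𝓞 K) // v ∉ S},
      ∏' c : {w : HeightOneSpectrum (𝓞 L) // w.under (𝓞 K) = v.1}, (X ∘ e) ⟨v, c⟩ = h v.1 := by
    intro v
    have hXe : ∀ c : {w : HeightOneSpectrum (𝓞 L) // w.under (𝓞 K) = v.1},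
        (X ∘ e) ⟨v, c⟩ = g c.1 := fun c => rfl
    rw [tprod_congr hXe]
    obtain ⟨hs, hi⟩ := tprod_fibre_eq hdeg hτ g (hS v.1 v.2)
    by_cases hex : ∃ w : HeightOneSpectrum (𝓞 L), w.under (𝓞 K) = v.1 ∧
        w.asIdeal.inertiaDeg (𝓞 K) = 1
    · obtain ⟨w, hw, hf⟩ := hex
      rw [hs w hw hf, hsplit v.1 v.2 w hw hf]
    · obtain ⟨w, hw, hf, -⟩ := fibre_of_not_exists_inertiaDeg_eq_one hdeg hτ (hS v.1 v.2) hex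
      rw [hi w hw hf, hinert v.1 v.2 w hw hf]
  have hsig := Multipliable.tprod_sigma' h₁ hmul
  have hmulK : Multipliable fun v : {v : HeightOneSpectrum (𝓞 K) // v ∉ S} =>
      ∏' c : {w : HeightOneSpectrum (𝓞 L) // w.under (𝓞 K) = v.1}, (X ∘ e) ⟨v, c⟩ :=
    hmul.sigma' h₁
  refine ⟨?_, ?_⟩
  · refine hmulK.congr fun v => hinner v
  · have hLHS : ∏' w : {w : HeightOneSpectrum (𝓞 L) // w.under (𝓞 K) ∉ S}, g w.1 =
        ∏' w, X w := rfl
    rw [hLHS, ← Equiv.tprod_eq e X, show (fun c => X (e c)) = X ∘ e from rfl, hsig]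
    exact tprod_congr hinner

/-- **Regrouping, two-sided form**: two multipliable families on the places of `L` outside the
preimage of `S` whose fibre products agree (`g w · g (τ • w) = g' w · g' (τ • w)` for degree-one
`w`, `g w = g' w` for degree-two `w`) have the same unconditional product.
[cite: ArthurClozelAMS120, Ch. 3, Lemma 4.3] -/
theorem regroup_tprod' [IsGalois K L] (hdeg : Module.finrank K L = 2) {τ : L ≃ₐ[K] L} (hτ : τ ≠ 1)
    (S : Set (HeightOneSpectrum (𝓞 K))) (g g' : HeightOneSpectrum (𝓞 L) → ℂ)
    (hS : ∀ v ∉ S, v.asIdeal.ramificationIdxIn (𝓞 L) = 1)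
    (hsplit : ∀ v ∉ S, ∀ w : HeightOneSpectrum (𝓞 L), w.under (𝓞 K) = v →
      w.asIdeal.inertiaDeg (𝓞 K) = 1 → g w * g (τ • w) = g' w * g' (τ • w))
    (hinert : ∀ v ∉ S, ∀ w : HeightOneSpectrum (𝓞 L), w.under (𝓞 K) = v →
      w.asIdeal.inertiaDeg (𝓞 K) = 2 → g w = g' w)
    (hg : Multipliable (fun w : {w : HeightOneSpectrum (𝓞 L) // w.under (𝓞 K) ∉ S} => g w.1))
    (hg' : Multipliable (fun w : {w : HeightOneSpectrum (𝓞 L) // w.under (𝓞 K) ∉ S} => g' w.1)) :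
    ∏' w : {w : HeightOneSpectrum (𝓞 L) // w.under (𝓞 K) ∉ S}, g w.1 =
      ∏' w : {w : HeightOneSpectrum (𝓞 L) // w.under (𝓞 K) ∉ S}, g' w.1 := by
  -- the common fibre product, as a function on the places of `K`
  set h : HeightOneSpectrum (𝓞 K) → ℂ := fun v =>
    ∏' c : {w : HeightOneSpectrum (𝓞 L) // w.under (𝓞 K) = v}, g c.1 with hh
  have key : ∀ (G : HeightOneSpectrum (𝓞 L) → ℂ),
      (∀ v ∉ S, ∀ w : HeightOneSpectrum (𝓞 L), w.under (𝓞 K) = v →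
        w.asIdeal.inertiaDeg (𝓞 K) = 1 → G w * G (τ • w) = g w * g (τ • w)) →
      (∀ v ∉ S, ∀ w : HeightOneSpectrum (𝓞 L), w.under (𝓞 K) = v →
        w.asIdeal.inertiaDeg (𝓞 K) = 2 → G w = g w) →
      Multipliable (fun w : {w : HeightOneSpectrum (𝓞 L) // w.under (𝓞 K) ∉ S} => G w.1) →
      ∏' w : {w : HeightOneSpectrum (𝓞 L) // w.under (𝓞 K) ∉ S}, G w.1 =
        ∏' v : {v : HeightOneSpectrum (𝓞 K) // v ∉ S}, h v.1 := by
    intro G hGs hGi hG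
    refine (regroup_tprod hdeg hτ S G h hS ?_ ?_ hG).2
    · intro v hv w hw hf
      rw [hGs v hv w hw hf, hh]
      exact ((tprod_fibre_eq hdeg hτ g (hS v hv)).1 w hw hf).symm
    · intro v hv w hw hf
      rw [hGi v hv w hw hf, hh]
      exact ((tprod_fibre_eq hdeg hτ g (hS v hv)).2 w hw hf).symm
  rw [key g (fun _ _ _ _ _ => rfl) (fun _ _ _ _ _ => rfl) hg,
    key g' (fun v hv w hw hf => (hsplit v hv w hw hf).symm) (fun v hv w hw hf => (hinert v hv w hw hf).symm) hg']

/-- **Registered helper `kleinHelper_regroup`** (the lead's sub-goal for the Klein-cube line of crux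
`InducedSquareAscent`): fibres of a quadratic Galois extension over an unramified place, finiteness
of ramification and of preimages of finite sets, and the two regrouping identities for unconditional
products along `w ↦ w ∩ 𝓞_K`, packaged in one statement (proved from the lemmas above).
[cite: ArthurClozelAMS120, Ch. 3, Lemma 4.3] -/
theorem kleinHelper_regroup :
    ∀ (K L : Type) [Field K] [NumberField K] [Field L] [NumberField L] [Algebra K L] [IsGalois K L],
      Module.finrank K L = 2 → ∀ (τ : L ≃ₐ[K] L), τ ≠ 1 →
      (∀ v : HeightOneSpectrum (𝓞 K), v.asIdeal.ramificationIdxIn (𝓞 L) = 1 →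
        ((∃ w : HeightOneSpectrum (𝓞 L), w.under (𝓞 K) = v ∧ w.asIdeal.inertiaDeg (𝓞 K) = 1) →
          ∀ w : HeightOneSpectrum (𝓞 L), w.under (𝓞 K) = v →
            w.asIdeal.inertiaDeg (𝓞 K) = 1 ∧ τ • w ≠ w ∧ w.residueCard = v.residueCard ∧
              ∀ w' : HeightOneSpectrum (𝓞 L), w'.under (𝓞 K) = v → w' = w ∨ w' = τ • w) ∧
        ((¬ ∃ w : HeightOneSpectrum (𝓞 L), w.under (𝓞 K) = v ∧ w.asIdeal.inertiaDeg (𝓞 K) = 1) →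
          ∃ w : HeightOneSpectrum (𝓞 L), w.under (𝓞 K) = v ∧ w.asIdeal.inertiaDeg (𝓞 K) = 2 ∧
            τ • w = w ∧ w.residueCard = v.residueCard ^ 2 ∧
            ∀ w' : HeightOneSpectrum (𝓞 L), w'.under (𝓞 K) = v → w' = w)) ∧
      ({v : HeightOneSpectrum (𝓞 K) | v.asIdeal.ramificationIdxIn (𝓞 L) ≠ 1}.Finite ∧
        ∀ S : Set (HeightOneSpectrum (𝓞 K)), S.Finite →
          {w : HeightOneSpectrum (𝓞 L) | w.under (𝓞 K) ∈ S}.Finite) ∧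
      (∀ (S : Set (HeightOneSpectrum (𝓞 K))) (g : HeightOneSpectrum (𝓞 L) → ℂ)
          (h : HeightOneSpectrum (𝓞 K) → ℂ),
        (∀ v ∉ S, v.asIdeal.ramificationIdxIn (𝓞 L) = 1) →
        (∀ v ∉ S, ∀ w : HeightOneSpectrum (𝓞 L), w.under (𝓞 K) = v →
          w.asIdeal.inertiaDeg (𝓞 K) = 1 → g w * g (τ • w) = h v) →
        (∀ v ∉ S, ∀ w : HeightOneSpectrum (𝓞 L), w.under (𝓞 K) = v →
          w.asIdeal.inertiaDeg (𝓞 K) = 2 → g w = h v) →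
        Multipliable (fun w : {w : HeightOneSpectrum (𝓞 L) // w.under (𝓞 K) ∉ S} => g w.1) →
        Multipliable (fun v : {v : HeightOneSpectrum (𝓞 K) // v ∉ S} => h v.1) ∧
          ∏' w : {w : HeightOneSpectrum (𝓞 L) // w.under (𝓞 K) ∉ S}, g w.1 =
            ∏' v : {v : HeightOneSpectrum (𝓞 K) // v ∉ S}, h v.1) ∧
      (∀ (S : Set (HeightOneSpectrum (𝓞 K))) (g g' : HeightOneSpectrum (𝓞 L) → ℂ),
        (∀ v ∉ S, v.asIdeal.ramificationIdxIn (𝓞 L) = 1) →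
        (∀ v ∉ S, ∀ w : HeightOneSpectrum (𝓞 L), w.under (𝓞 K) = v →
          w.asIdeal.inertiaDeg (𝓞 K) = 1 → g w * g (τ • w) = g' w * g' (τ • w)) →
        (∀ v ∉ S, ∀ w : HeightOneSpectrum (𝓞 L), w.under (𝓞 K) = v →
          w.asIdeal.inertiaDeg (𝓞 K) = 2 → g w = g' w) →
        Multipliable (fun w : {w : HeightOneSpectrum (𝓞 L) // w.under (𝓞 K) ∉ S} => g w.1) →
        Multipliable (fun w : {w : HeightOneSpectrum (𝓞 L) // w.under (𝓞 K) ∉ S} => g' w.1) →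
          ∏' w : {w : HeightOneSpectrum (𝓞 L) // w.under (𝓞 K) ∉ S}, g w.1 =
            ∏' w : {w : HeightOneSpectrum (𝓞 L) // w.under (𝓞 K) ∉ S}, g' w.1) := by
  intro K L _ _ _ _ _ _ hdeg τ hτ
  refine ⟨fun v hv => ⟨fun hex w hw => ?_, fun hne => ?_⟩, ⟨?_, fun S hS => finite_setOf_under_mem hS⟩,
    fun S g h hS hs hi hg => regroup_tprod hdeg hτ S g h hS hs hi hg,
    fun S g g' hS hs hi hg hg' => regroup_tprod' hdeg hτ S g g' hS hs hi hg hg'⟩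
  · have hf : w.asIdeal.inertiaDeg (𝓞 K) = 1 := inertiaDeg_eq_one_of_exists hex hw
    obtain ⟨hne, hq, hall⟩ := fibre_of_inertiaDeg_eq_one hdeg hτ hv hw hf
    exact ⟨hf, hne, hq, hall⟩
  · exact fibre_of_not_exists_inertiaDeg_eq_one hdeg hτ hv hne
  · have h := (eventually_ramificationIdxIn_eq_one (K := K) (L := L))
    rw [Filter.eventually_cofinite] at h
    exact h

end Summit.Langlands.Langlands.Theorems.InducedSquareAscentKleinCube

end
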